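import Summits.Ventures.LatticeQCDFlow.Exactness.FlowSamplerGroupSymmetrisation
import Summits.Ventures.LatticeQCDFlow.Exactness.FlowSamplerSymmetrisationDirichlet
import HarnessLib

/-!
# AVERAGING A FLOW OVER A FINITE SYMMETRY GROUP: the Dirichlet form of the group-averaged flow sampler dominates that of the flow sampler on every symmetry sector

HONEST FRAMING: exact (Metropolis-corrected) sampling algorithms for lattice gauge theory;
figures of merit are autocorrelation/cost numbers at stated couplings and volumes; no
continuum-physics claim.  (SCALAR calibration rung S0-A: not a gauge result.)

Venture `LatticeQCDFlow` (cell pub-lqcd), topic `Exactness`; FANOUT row 2 (`s0-phi4`, FLOW arm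
`K_q = imhOp μ w q̃`, group-averaged arm `K_q̄ = imhOp μ w q̄`, `q̄ = N⁻¹ Σ_a q̃ ∘ t_a`).  NEW WORK of the
cell: the finite-group version of `FlowSamplerSymmetrisationDirichlet` (there: ONE involution `σ`,
the `Z₂` of φ⁴; here: a finite family / a finite GROUP of measure-preserving symmetries of the target
— lattice translations, rotations and reflections with symmetric couplings, the global flip, the
`Z_N` centre, charge conjugation).  The construction `q̄` is the 'single-model symmetrized mixture' of
Boyda et al. 2021 / Hackett et al. 2021 §4.2 (NAMED, used there empirically); the nearest printed
ordering is Tierney 1998 Prop. 5 / Liu 2001 Thm 13.3.4 (IN THE TREE, finite state space: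
`Literature.Probability.MarkovChains.MixtureProposalPeskun`), which compares `K_q̄` with the MIXTURE
`N⁻¹ Σ_a K_{q̃∘t_a}`; the present file compares `K_q̄` with the un-averaged `K_q̃` itself, which is
possible on SYMMETRY SECTORS only (functions `u` with `u ∘ t_a = χ(a)·u`, `χ(a)² = 1` — invariant
observables `χ ≡ 1`, and sign characters such as the magnetisation under the flip or a staggered
observable under the unit translation).  Peskun 1973 / Tierney 1998 / Andrieu–Livingstone 2021
NAMED for the shape of the argument; nothing is cited as a fact.

## What is proved (`t : G → (X ≃ᵐ X)` measure preserving, `w ∘ t_a = w`, `w, q̃ > 0`, `∫ q̃ = 1`;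
`s_q(x,y) = min(w(x)q(y), w(y)q(x))` the symmetric flow kernel, `𝓔_q(v) = ∫ v² w − ∫ v (K_q v) w`)

* `integral_comp_prodMap_symmetry` — `∫ F(t_a x, t_a y) d(μ⊗μ) = ∫ F d(μ⊗μ)`;
* **`groupAvg_imhFlow_ge`** — `N⁻¹ Σ_a s_q̃(t_a x, t_a y) ≤ s_q̄(x, y)` (`min` is superadditive; NO group
  law needed, any finite family);
* **`groupAvg_dirichlet_ge_of_covariant`** — for every square-integrable `u` with `u ∘ t_a = χ(a)·u`,
  `χ(a)² = 1` for all `a`: **`𝓔_q̄(u) ≥ 𝓔_q̃(u)`** (any finite family; the orbit average of `𝓔_q̃` is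
  `𝓔_q̃` on such `u`, and is dominated by `𝓔_q̄` termwise);
* with the GROUP LAW `t_{ab} = t_a ∘ t_b`: `groupAvg_comp_symmetry` (`q̄ ∘ t_b = q̄`),
  `groupAvg_imhFlow_comp_symmetry` (`s_q̄(t_b x, t_b y) = s_q̄(x,y)`), `sqClass_comp_symmetry`, and
  **`groupAvg_dirichlet_comp_symmetry`** — `𝓔_q̄(v ∘ t_b) = 𝓔_q̄(v)` for every square-integrable `v`.

The `τ_int` comparison on symmetry sectors (projection onto the sector, the tree's format-level
variational calculus) is drawn in the sequel `FlowSamplerGroupSymmetrisationTauInt`; lattice instances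
(site permutations preserving the couplings, with and without the flip) in the lattice files.
NOT CLAIMED: anything for observables outside a symmetry sector (for the `Z₂` case a three-state
witness shows the Dirichlet ordering FAILS off the parity sectors — separate file); strictness; any
value for any network; cost accounting (`N` density evaluations per proposal); HMC / local arms.
-/

namespace Summit.Ventures.LatticeQCDFlow.Exactness

open Real MeasureTheory Filter Finset Set Topology
open Summit.Ventures.LatticeQCDFlow.Scoring

section General

variable {X : Type*} [MeasurableSpace X] {μ : Measure X} [SFinite μ] {w q : X → ℝ}
  {G : Type*} [Fintype G] [Nonempty G] {t : G → X ≃ᵐ X}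

/-! ## §1 Change of variables on the product space -/

omit [Fintype G] [Nonempty G] in
/-- `(x, y) ↦ (t_a x, t_a y)` preserves `μ ⊗ μ`: `∫ F(t_a x, t_a y) = ∫ F`. -/
theorem integral_comp_prodMap_symmetry (ht : ∀ a, MeasurePreserving (t a) μ μ) (a : G)
    (F : X × X → ℝ) : ∫ p, F (t a p.1, t a p.2) ∂(μ.prod μ) = ∫ p, F p ∂(μ.prod μ) :=
  ((ht a).prod (ht a)).integral_comp ((t a).prodCongr (t a)).measurableEmbedding F

omit [Fintype G] [Nonempty G] in
/-- … and `F ∘ (t_a × t_a) ∈ L¹(μ ⊗ μ)` whenever `F ∈ L¹(μ ⊗ μ)`. -/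
theorem integrable_comp_prodMap_symmetry (ht : ∀ a, MeasurePreserving (t a) μ μ) (a : G)
    {F : X × X → ℝ} (hF : Integrable F (μ.prod μ)) :
    Integrable (fun p : X × X => F (t a p.1, t a p.2)) (μ.prod μ) :=
  (((ht a).prod (ht a)).integrable_comp_emb ((t a).prodCongr (t a)).measurableEmbedding).2 hF

omit [SFinite μ] [Fintype G] [Nonempty G] in
/-- `v ∘ t_a` is square-integrable against `w` when `v` is (`w ∘ t_a = w`, `t_a` measure preserving). -/
theorem sqClass_comp_symmetry (ht : ∀ a, MeasurePreserving (t a) μ μ)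
    (hw : ∀ a x, w (t a x) = w x) (a : G) {v : X → ℝ} (hvm : Measurable v)
    (hv2 : Integrable (fun x => v x ^ 2 * w x) μ) :
    Measurable (fun x => v (t a x)) ∧ Integrable (fun x => v (t a x) ^ 2 * w x) μ := by
  refine ⟨hvm.comp (t a).measurable, ?_⟩
  have h := integrable_comp_symmetry ht a hv2
  exact h.congr (Eventually.of_forall fun x => by simp only [hw])

/-! ## §2 Kernel facts -/

omit [MeasurableSpace X] [Nonempty G] in
/-- **The group-averaged flow kernel dominates the orbit average of the flow kernel**:
`N⁻¹ Σ_a s_q̃(t_a x, t_a y) ≤ s_q̄(x, y)` (`w ∘ t_a = w`; any finite family, no group law). -/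
theorem groupAvg_imhFlow_ge {t : G → X → X} (hw : ∀ a x, w (t a x) = w x) (x y : X) :
    (∑ a, imhFlow w q (t a x) (t a y)) / Fintype.card G
      ≤ imhFlow w (fun s => (∑ a, q (t a s)) / Fintype.card G) x y := by
  have hN : (0 : ℝ) ≤ Fintype.card G := by positivity
  unfold imhFlow
  simp only [hw]
  have h := Literature.Probability.MarkovChains.sum_min_le_min_sum Finset.univ
    (fun a => w x * q (t a y)) (fun a => w y * q (t a x))
  have e1 : w x * ((∑ a, q (t a y)) / Fintype.card G) = (∑ a, w x * q (t a y)) / Fintype.card G := by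
    rw [← Finset.mul_sum]; ring
  have e2 : w y * ((∑ a, q (t a x)) / Fintype.card G) = (∑ a, w y * q (t a x)) / Fintype.card G := by
    rw [← Finset.mul_sum]; ring
  rw [e1, e2, min_div_div_right hN]
  exact div_le_div_of_nonneg_right h hN

variable [Group G]

omit [MeasurableSpace X] [Nonempty G] in
/-- With the group law `t_{ab} = t_a ∘ t_b`: **`q̄ ∘ t_b = q̄`** (reindex `a ↦ a b`). -/
theorem groupAvg_comp_symmetry {t : G → X → X} (hmul : ∀ a b x, t (a * b) x = t a (t b x))
    (b : G) (x : X) :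
    (∑ a, q (t a (t b x))) / Fintype.card G = (∑ a, q (t a x)) / Fintype.card G := by
  congr 1
  simp_rw [← hmul]
  exact Fintype.sum_equiv (Equiv.mulRight b) (fun a => q (t (a * b) x)) (fun c => q (t c x))
    fun a => rfl

omit [MeasurableSpace X] [Nonempty G] in
/-- The group-averaged flow kernel is invariant along the group: `s_q̄(t_b x, t_b y) = s_q̄(x, y)`. -/
theorem groupAvg_imhFlow_comp_symmetry {t : G → X → X} (hmul : ∀ a b x, t (a * b) x = t a (t b x))
    (hw : ∀ a x, w (t a x) = w x) (b : G) (x y : X) :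
    imhFlow w (fun s => (∑ a, q (t a s)) / Fintype.card G) (t b x) (t b y)
      = imhFlow w (fun s => (∑ a, q (t a s)) / Fintype.card G) x y := by
  unfold imhFlow
  beta_reduce
  rw [hw b x, hw b y, groupAvg_comp_symmetry hmul b x, groupAvg_comp_symmetry hmul b y]

/-! ## §3 Dirichlet-form domination on symmetry sectors (any finite family) -/

omit [Group G] in
/-- **`𝓔_q̄(u) ≥ 𝓔_q̃(u)` FOR EVERY SQUARE-INTEGRABLE `u` IN A SYMMETRY SECTOR** (`u ∘ t_a = χ(a)·u`,
`χ(a)² = 1` for all `a`): `∫ u² w − ∫ u (K_q̃ u) w ≤ ∫ u² w − ∫ u (K_q̄ u) w`.  No group law is used: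
any finite nonempty family of measure-preserving symmetries of `w`. -/
theorem groupAvg_dirichlet_ge_of_covariant (ht : ∀ a, MeasurePreserving (t a) μ μ)
    (hw0 : ∀ x, 0 < w x) (hwm : Measurable w) (hwi : Integrable w μ) (hw : ∀ a x, w (t a x) = w x)
    (hq0 : ∀ x, 0 < q x) (hqm : Measurable q) (hqi : Integrable q μ) (hq1 : ∫ z, q z ∂μ = 1)
    {u : X → ℝ} (hum : Measurable u) (hu2 : Integrable (fun x => u x ^ 2 * w x) μ)
    {χ : G → ℝ} (hχ2 : ∀ a, χ a ^ 2 = 1) (hu : ∀ a x, u (t a x) = χ a * u x) :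
    (∫ x, u x ^ 2 * w x ∂μ) - ∫ x, u x * imhOp μ w q u x * w x ∂μ
      ≤ (∫ x, u x ^ 2 * w x ∂μ)
        - ∫ x, u x * imhOp μ w (fun s => (∑ a, q (t a s)) / Fintype.card G) u x * w x ∂μ := by
  have hN : (0 : ℝ) < Fintype.card G := by exact_mod_cast Fintype.card_pos
  obtain ⟨hs0, hsm, hsi, hs1⟩ := groupAvg_facts ht hq0 hqm hqi hq1
  rw [dirichlet_eq_half_sq_of_sq hw0 hwm hwi hq0 hqm hqi hq1 hum hu2,
    dirichlet_eq_half_sq_of_sq hw0 hwm hwi hs0 hsm hsi hs1 hum hu2]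
  refine mul_le_mul_of_nonneg_left ?_ (by norm_num)
  set F : X × X → ℝ := fun p => imhFlow w q p.1 p.2 * (u p.1 - u p.2) ^ 2 with hF
  have hFi : Integrable F (μ.prod μ) := integrable_imhFlow_mul_sq_sub hw0 hwm hq0 hqm hqi hum hu2
  have hFai : ∀ a, Integrable (fun p : X × X => F (t a p.1, t a p.2)) (μ.prod μ) := fun a =>
    integrable_comp_prodMap_symmetry ht a hFi
  -- along each symmetry the integrand keeps its `(u − u')²` factor
  have hFa_eq : ∀ a (p : X × X),
      F (t a p.1, t a p.2) = imhFlow w q (t a p.1) (t a p.2) * (u p.1 - u p.2) ^ 2 := fun a p => by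
    show imhFlow w q (t a p.1) (t a p.2) * (u (t a p.1) - u (t a p.2)) ^ 2
      = imhFlow w q (t a p.1) (t a p.2) * (u p.1 - u p.2) ^ 2
    rw [hu, hu]
    have e : (χ a * u p.1 - χ a * u p.2) ^ 2 = χ a ^ 2 * (u p.1 - u p.2) ^ 2 := by ring
    rw [e, hχ2, one_mul]
  have hint_a : ∀ a, ∫ p, F (t a p.1, t a p.2) ∂(μ.prod μ) = ∫ p, F p ∂(μ.prod μ) := fun a =>
    integral_comp_prodMap_symmetry ht a F
  have hGi : Integrable (fun p : X × X =>
      imhFlow w (fun s => (∑ a, q (t a s)) / Fintype.card G) p.1 p.2 * (u p.1 - u p.2) ^ 2)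
      (μ.prod μ) := integrable_imhFlow_mul_sq_sub hw0 hwm hs0 hsm hsi hum hu2
  -- pointwise: the orbit average of the integrand is dominated by the averaged kernel's integrand
  have hpt : ∀ p : X × X, (∑ a, F (t a p.1, t a p.2)) / Fintype.card G
      ≤ imhFlow w (fun s => (∑ a, q (t a s)) / Fintype.card G) p.1 p.2 * (u p.1 - u p.2) ^ 2 :=
    fun p => by
      simp only [hFa_eq]
      rw [← Finset.sum_mul, ← div_mul_eq_mul_div]
      exact mul_le_mul_of_nonneg_right
        (groupAvg_imhFlow_ge (q := q) (t := fun a => (t a : X → X)) hw p.1 p.2) (sq_nonneg _)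
  calc ∫ p, F p ∂(μ.prod μ) = ∫ p, (∑ a, F (t a p.1, t a p.2)) / Fintype.card G ∂(μ.prod μ) := by
        rw [integral_div, integral_finsetSum Finset.univ fun a _ => hFai a]
        simp only [hint_a, Finset.sum_const, Finset.card_univ, nsmul_eq_mul]
        field_simp
    _ ≤ ∫ p, imhFlow w (fun s => (∑ a, q (t a s)) / Fintype.card G) p.1 p.2 * (u p.1 - u p.2) ^ 2
          ∂(μ.prod μ) :=
        integral_mono ((integrable_finsetSum Finset.univ fun a _ => hFai a).div_const _) hGi hpt

omit [Group G] in
/-- **INVARIANT OBSERVABLES** (`u ∘ t_a = u` for all `a`, the sector `χ ≡ 1`): `𝓔_q̄(u) ≥ 𝓔_q̃(u)`. -/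
theorem groupAvg_dirichlet_ge_of_invariant (ht : ∀ a, MeasurePreserving (t a) μ μ)
    (hw0 : ∀ x, 0 < w x) (hwm : Measurable w) (hwi : Integrable w μ) (hw : ∀ a x, w (t a x) = w x)
    (hq0 : ∀ x, 0 < q x) (hqm : Measurable q) (hqi : Integrable q μ) (hq1 : ∫ z, q z ∂μ = 1)
    {u : X → ℝ} (hum : Measurable u) (hu2 : Integrable (fun x => u x ^ 2 * w x) μ)
    (hu : ∀ a x, u (t a x) = u x) :
    (∫ x, u x ^ 2 * w x ∂μ) - ∫ x, u x * imhOp μ w q u x * w x ∂μ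
      ≤ (∫ x, u x ^ 2 * w x ∂μ)
        - ∫ x, u x * imhOp μ w (fun s => (∑ a, q (t a s)) / Fintype.card G) u x * w x ∂μ :=
  groupAvg_dirichlet_ge_of_covariant ht hw0 hwm hwi hw hq0 hqm hqi hq1 hum hu2 (χ := fun _ => 1)
    (fun _ => one_pow 2) (fun a x => by rw [hu, one_mul])

/-! ## §4 Invariance of the group-averaged Dirichlet form along the group -/

/-- **`𝓔_q̄(v ∘ t_b) = 𝓔_q̄(v)`** for every square-integrable `v` (group law `t_{ab} = t_a ∘ t_b`:
the averaged kernel is `t_b × t_b`-invariant; change of variables). -/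
theorem groupAvg_dirichlet_comp_symmetry (ht : ∀ a, MeasurePreserving (t a) μ μ)
    (hmul : ∀ a b x, t (a * b) x = t a (t b x)) (hw0 : ∀ x, 0 < w x) (hwm : Measurable w)
    (hwi : Integrable w μ) (hw : ∀ a x, w (t a x) = w x) (hq0 : ∀ x, 0 < q x) (hqm : Measurable q)
    (hqi : Integrable q μ) (hq1 : ∫ z, q z ∂μ = 1) (b : G) {v : X → ℝ} (hvm : Measurable v)
    (hv2 : Integrable (fun x => v x ^ 2 * w x) μ) :
    (∫ x, v (t b x) ^ 2 * w x ∂μ)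
        - ∫ x, v (t b x) * imhOp μ w (fun s => (∑ a, q (t a s)) / Fintype.card G)
            (fun y => v (t b y)) x * w x ∂μ
      = (∫ x, v x ^ 2 * w x ∂μ)
        - ∫ x, v x * imhOp μ w (fun s => (∑ a, q (t a s)) / Fintype.card G) v x * w x ∂μ := by
  obtain ⟨hs0, hsm, hsi, hs1⟩ := groupAvg_facts ht hq0 hqm hqi hq1
  obtain ⟨hvbm, hvb2⟩ := sqClass_comp_symmetry ht hw b hvm hv2
  rw [dirichlet_eq_half_sq_of_sq hw0 hwm hwi hs0 hsm hsi hs1 hvbm hvb2,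
    dirichlet_eq_half_sq_of_sq hw0 hwm hwi hs0 hsm hsi hs1 hvm hv2,
    ← integral_comp_prodMap_symmetry ht b (fun p : X × X =>
      imhFlow w (fun s => (∑ a, q (t a s)) / Fintype.card G) p.1 p.2 * (v p.1 - v p.2) ^ 2)]
  congr 1
  refine integral_congr_ae (Eventually.of_forall fun p => ?_)
  show imhFlow w (fun s => (∑ a, q (t a s)) / Fintype.card G) p.1 p.2 * (v (t b p.1) - v (t b p.2)) ^ 2
    = imhFlow w (fun s => (∑ a, q (t a s)) / Fintype.card G) (t b p.1) (t b p.2)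
      * (v (t b p.1) - v (t b p.2)) ^ 2
  rw [groupAvg_imhFlow_comp_symmetry (q := q) (t := fun a => (t a : X → X)) hmul hw]

end General

end Summit.Ventures.LatticeQCDFlow.Exactness
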